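import Summits.HodgeConjecture.HodgeConjecture.Theorems.CyclicUnitaryPowersCurvesOfLargeMonodromyHodgeOffCountable
import Literature.AlgebraicGeometry.HodgeTheory.MonodromyMumfordTateHeredity
import HarnessLib

/-!
# Route CyclicUnitaryPowers — HEREDITY ALONG CURVES: if ONE member of an algebraic curve of `p`-cyclic surfaces has a
# finite-index monodromy subgroup in its Mumford–Tate group, then so do ALL BUT COUNTABLY MANY members, and the
# Hodge conjecture holds on all their self-powers (CDK-free; no hypothesis on the monodromy of the curve)

Support file for `stmt-HodgeConjecture-19544` (`--supports`; nothing here closes an item). Prover seat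
`hodge-nonav-prover-Ax` (g16, cell hodge-nonav), programme «HEREDITY» (p3 g35 GO 2026-08-29 06:03Z).

Setting: `p ≥ 7` prime; `u = cyclicCoverFamily p : 𝒴 ⟶ S` the Carlson–Toledo family of smooth `p`-cyclic surfaces
`x₃^p = f(x₀,x₁,x₂)`; `Γ_t` its monodromy group at `t ∈ S(ℂ)` on `H²(𝒴_t(ℂ); ℚ)`; **FI(t)**: «some finite-index subgroup
of `Γ_t` lies in the Mumford–Tate group `MT(H²(𝒴_t))(ℚ)`» (read in Hodge-symmetric models `A`). FI(t) holds at every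
Hodge-generic `t` (Deligne's lemma, tree theorem `deligne_finiteIndex_monodromy_le_mumfordTateGroup_of_isQuasiProjectiveOver`)
and FI(t) ⇒ HC on all self-powers of every surface cut out by the form of `t` (the per-point kernel
`hodgeConjectureFor_powers_of_finiteIndex_le_mumfordTate`, g13; restated at a point of the constructed family as
`hodgeConjectureFor_powers_of_finiteIndex_at`).

MAIN THEOREM (`exists_countable_finiteIndex_of_curve`). Let `P` be a smooth irreducible quasi-projective CURVE with
`P(ℂ)` path connected and `ι : P ⟶ S` a morphism (an algebraic one-parameter family of smooth `p`-cyclic surfaces). If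
FI(ι c₀) for ONE `c₀ ∈ P(ℂ)`, then there is a COUNTABLE `C ⊆ P(ℂ)` with FI(ι c) for every `c ∉ C`. Hence
(`hodgeConjectureFor_powers_offCountable_of_curve_of_finiteIndex`) HC on all self fibre powers of every surface of the
curve off `C`; and (`…_of_isHodgeGenericPoint`) the same for every curve through a Hodge-generic point of `S`.

Compared with g13's `hodgeConjectureFor_powers_offCountable_of_curve` the LARGE-MONODROMY hypothesis (HL) on the curve
(Zariski∕Lefschetz: `π₁` of the curve surjects) is GONE: it is replaced by FI at one point, which propagates along the
curve by CMSP (15.7) for the pulled-back family `π' = 𝒴 ×_S P → P`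
(`exists_finiteIndex_le_mumfordTateGroup_map_of_isHodgeGenericPoint_familyPullback`, Literature HEREDITY H1) to every
`π'`-Hodge-generic point — and over a curve the non-generic points of `π'` are COUNTABLE without Cattani–Deligne–Kaplan
(`exists_countable_isHodgeGenericPoint_of_weightTwoFrames_curve`, weight-two frames from Griffiths residues).

HONEST FRAMING: structural and unconditional (axioms standard, no named fact); the exceptional set is countable and
unspecified; FI at the seed point is a HYPOTHESIS (transcendental: e.g. Hodge-genericity); items 19544 ∕ 19543 stay OPEN at
their Cattani–Deligne–Kaplan floor (reading (b)); rung F-H1 not moved; nothing here says HC ∕ HC_CM ∕ HC_AV is proved.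

## References
* [CarlsonMullerStachPeters2017] J. Carlson, S. Müller-Stach, C. Peters, Period Mappings and Period Domains, 2nd ed.,
  §15.3 (15.7) and Lemma–Def. 15.3.7.
* [Deligne1972WeilK3] P. Deligne, La conjecture de Weil pour les surfaces K3, Invent. Math. 15 (1972), Prop. 7.5.
* [CarlsonToledo1999] J. A. Carlson, D. Toledo, Duke Math. J. 97 (1999), §7 Theorem 7.1.
* [VoisinHodgeII2003] C. Voisin, *Hodge Theory and Complex Algebraic Geometry II*, §3.1.2.
-/

noncomputable section

set_option linter.dupNamespace false

namespace Summit.HodgeConjecture.HodgeConjecture.Theorems.CyclicUnitaryPowersHeredity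

open scoped TensorProduct Topology
open CategoryTheory CategoryTheory.Limits AlgebraicGeometry
open _root_.Topology _root_.Filter
open Literature.AlgebraicGeometry.Motives Literature.AlgebraicGeometry.HodgeTheory
open Literature.AlgebraicGeometry.HodgeTheory.BettiUniverse
open Literature.AlgebraicGeometry.Motives.UniversalHypersurface Literature.AlgebraicGeometry.HodgeTheory.UniversalHypersurface
open Literature.AlgebraicTopology.SingularHomology
open Summit.HodgeConjecture.HodgeConjecture.Theorems.CyclicUnitaryPowersNodalMeridianMonodromy
open Summit.HodgeConjecture.HodgeConjecture.Theorems.CyclicUnitaryPowersFiniteIndexMonodromyDeckCommutators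
open Summit.HodgeConjecture.HodgeConjecture.Theorems.CyclicUnitaryPowersGenericCyclicSurfacePowersHodge

/-! ### §1 The per-point kernel at a point of the constructed Carlson–Toledo family -/

/-- **FI at a point `t` of the Carlson–Toledo base ⇒ the Hodge conjecture on all self fibre powers of every smooth
projective surface cut out by `x₃^p − f_t`**, `f_t` the ternary form of `t` (`p ≥ 7` prime; models `A` arbitrary
Hodge-symmetric). This is g13's per-point kernel `hodgeConjectureFor_powers_of_finiteIndex_le_mumfordTate` for the
Carlson–Toledo structure on `cyclicCoverFamily p` built from the PROVED nodal-meridian bound F1‡, with the classifying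
point `pt f_t` rewritten to `t`. [cite: CarlsonMullerStachPeters2017, Lemma–Definition 15.3.7]
[cite: CarlsonToledo1999, §7 Theorem 7.1] -/
theorem hodgeConjectureFor_powers_of_finiteIndex_at {p : ℕ} (hp : p.Prime) (h7 : 7 ≤ p)
    (A : haveI : NeZero p := ⟨hp.ne_zero⟩; ∀ t : ComplexPoints (cyclicCoverBase p), HodgeModel 2 (fiberOver (cyclicCoverFamily p) t))
    (hA : ∀ t, (A t).IsHodgeSymmetric)
    (t : haveI : NeZero p := ⟨hp.ne_zero⟩; ComplexPoints (cyclicCoverBase p))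
    (hFI : haveI : NeZero p := ⟨hp.ne_zero⟩
      haveI : HodgeTensorFacts.{0, 0} := hodgeTensorFacts_holds
      haveI : ∀ t : ComplexPoints (cyclicCoverBase p), Module.Finite ℚ (bettiCohomology (fiberOver (cyclicCoverFamily p) t) 2) :=
        fun t => finite ((isSmoothProjectiveFamily_cyclicCoverFamily p).isSmoothProjective t) 2
      ∃ Γ₀ : Subgroup (bettiCohomology (fiberOver (cyclicCoverFamily p) t) 2 ≃ₗ[ℚ]
          bettiCohomology (fiberOver (cyclicCoverFamily p) t) 2),
        Γ₀ ≤ ratMonodromyGroup (cyclicCoverFamily p) 2 (cyclicCoverFamily_locallyTrivial p) ⟨t, Set.mem_univ _⟩ ∧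
        (Γ₀.subgroupOf (ratMonodromyGroup (cyclicCoverFamily p) 2 (cyclicCoverFamily_locallyTrivial p) ⟨t, Set.mem_univ _⟩)).FiniteIndex ∧
        Γ₀ ≤ ((A t).hodgeStructure ((isSmoothProjectiveFamily_cyclicCoverFamily p).isSmoothProjective t) (hA t) 2).mumfordTateGroup)
    ⦃X : SchemeOver ℂ⦄ (hX : IsSmoothProjective 2 X)
    (hcut : haveI : NeZero p := ⟨hp.ne_zero⟩
      IsHypersurfaceCutOutBy 3 (MvPolynomial.X (Fin.last 3) ^ p - MvPolynomial.rename Fin.castSucc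
        (∑ e : TernaryIndex p, MvPolynomial.monomial e.1 ((branchForm p t).coeff e.1))) X)
    ⦃k : ℕ⦄ ⦃Y : SchemeOver ℂ⦄ (hY : ∃ π : Fin (k + 1) → (Y ⟶ X), Nonempty (IsLimit (Fan.mk Y π))) :
    HodgeConjectureFor (2 * (k + 1)) Y := by
  haveI : NeZero p := ⟨hp.ne_zero⟩
  haveI : HodgeTensorFacts.{0, 0} := hodgeTensorFacts_holds
  have hp2 : 2 ≤ p := by omega
  have hf := isSmoothProjectiveFamily_cyclicCoverFamily p
  have hU := cyclicCoverFamily_locallyTrivial p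
  haveI : ∀ t : ComplexPoints (cyclicCoverBase p), Module.Finite ℚ (bettiCohomology (fiberOver (cyclicCoverFamily p) t) 2) :=
    fun t => finite (hf.isSmoothProjective t) 2
  have hfh : (∑ e : TernaryIndex p, MvPolynomial.monomial e.1 ((branchForm p t).coeff e.1)).IsHomogeneous p :=
    isHomogeneous_sum_monomial p _
  have hf0 := sum_monomial_coeff_branchForm_ne_zero p hp2 t
  obtain ⟨eX⟩ := hcut.nonempty_iso_hypersurface
  have hXF : IsSmoothProjective 2 (SmoothHypersurface.hypersurface
      (MvPolynomial.X (Fin.last 3) ^ p - MvPolynomial.rename Fin.castSucc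
        (∑ e : TernaryIndex p, MvPolynomial.monomial e.1 ((branchForm p t).coeff e.1)))) :=
    hX.of_iso eX
  have hJ : SmoothHypersurface.IsNonsingularForm ℂ (cyclicCoverForm p
      (∑ e : TernaryIndex p, MvPolynomial.monomial e.1 ((branchForm p t).coeff e.1))) :=
    CyclicCoverFormNonsingular.isNonsingularForm_cyclicCoverForm_of_isSmoothProjective hp2 hfh hf0 hXF
  have hpt : cyclicCoverPoint p (∑ e : TernaryIndex p, MvPolynomial.monomial e.1 ((branchForm p t).coeff e.1)) = t :=
    coeffChart_injective p (funext fun e => by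
      change (branchForm p (cyclicCoverPoint p _)).coeff e.1 = (branchForm p t).coeff e.1
      rw [coeffChart_cyclicCoverPoint hfh hJ e]
      exact coeff_sum_monomial p _ e)
  -- the Carlson–Toledo structure on the constructed family (from F1‡, proved)
  have hsys := fun (g : MvPolynomial (Fin 3) ℂ) (hg : g.IsHomogeneous p) (hg0 : g ≠ 0)
      (hXg : IsSmoothProjective 2 (SmoothHypersurface.hypersurface (cyclicCoverForm p g))) =>
    CyclicUnitaryPowersPLPackageOfLocalMonodromyBound.exists_cyclicReflectionSystem_of_localMonodromyBound
      carlsonToledo1999_nodalMeridianLocalMonodromyBound_holds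
      EisenbudHarris2016_surface_secondBettiNumber_holds hp h7 hg hg0 hXg
  let 𝔉 : CarlsonToledoFamily p :=
    { Y := cyclicCoverTotal p
      S := cyclicCoverBase p
      u := cyclicCoverFamily p
      isSmoothProjectiveFamily := isSmoothProjectiveFamily_cyclicCoverFamily p
      isQuasiProjectiveOver := isQuasiProjectiveOver_baseSpz 2 p (cyclicCoverSpz p)
      isQuasiProjectiveOver_total :=
        isQuasiProjectiveOver_totalSpz 2 p (cyclicCoverSpz p) (cyclicCoverSpz_surjective p (NeZero.ne p))
      smooth := smooth_baseSpz_hom ℂ 2 p (cyclicCoverSpz p)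
      irreducibleSpace := irreducibleSpace_cyclicCoverBase p
      locallyTrivial := cyclicCoverFamily_locallyTrivial p
      pt := cyclicCoverPoint p
      exists_polynomials := cyclicCoverPoint_exists_polynomials p hp2
      pt_surjective := cyclicCoverPoint_surjective p hp2
      iso := fun g hg hg0 hXg => (hsys g hg hg0 hXg).choose
      deck := fun g hg hg0 hXg => (hsys g hg hg0 hXg).choose_spec.choose
      pullEquiv_deck := fun g hg hg0 hXg ha x => (hsys g hg hg0 hXg).choose_spec.choose_spec.1 ha x
      system := fun g hg hg0 hXg => ((hsys g hg hg0 hXg).choose_spec.choose_spec.2).some }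
  -- generalise over the point to substitute `pt f_t = t`
  have key : ∀ t' : ComplexPoints (cyclicCoverBase p), t' = t →
      ∃ Γ₁ : Subgroup (bettiCohomology (fiberOver (cyclicCoverFamily p) t') 2 ≃ₗ[ℚ]
          bettiCohomology (fiberOver (cyclicCoverFamily p) t') 2),
        Γ₁ ≤ ratMonodromyGroup (cyclicCoverFamily p) 2 hU ⟨t', Set.mem_univ _⟩ ∧
        (Γ₁.subgroupOf (ratMonodromyGroup (cyclicCoverFamily p) 2 hU ⟨t', Set.mem_univ _⟩)).FiniteIndex ∧
        Γ₁ ≤ ((A t').hodgeStructure (hf.isSmoothProjective t') (hA t') 2).mumfordTateGroup := by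
    rintro t' rfl
    exact hFI
  exact hodgeConjectureFor_powers_of_finiteIndex_le_mumfordTate hp h7 𝔉 _ hfh hf0 hXF A hA (key _ hpt) hX hcut hY

/-! ### §2 FI at one point of a curve propagates to all but countably many points -/

/-- **HEREDITY ALONG CURVES.** `p ≥ 7` prime; `P` a smooth irreducible quasi-projective curve with `P(ℂ)` path
connected; `ι : P ⟶ S = cyclicCoverBase p`; Hodge-symmetric models `A` of the fibres of the Carlson–Toledo family. If at
ONE point `c₀ ∈ P(ℂ)` some finite-index subgroup of the monodromy group `Γ_{ι c₀}` of the Carlson–Toledo family lies in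
`MT(H²(𝒴_{ι c₀}))(ℚ)` — hypothesis `hFI`, stated at a point `t₀ = ι c₀` of `S(ℂ)` — then there is a COUNTABLE `C ⊆ P(ℂ)`
such that the same holds at `ι c` for every `c ∉ C`. NO hypothesis on the monodromy of the curve. Chain: weight-two frames of
the pulled-back family `π'` from Griffiths residues (`exists_frames_familyPullback_chartAt`, g13) ⇒ the non-`π'`-generic points
are countable (`exists_countable_isHodgeGenericPoint_of_weightTwoFrames_curve`); rational transports of `π'` exist along paths
(`isRationalClass_transportFun_of_isSmoothProjectiveFamily`); HEREDITY H1
(`exists_finiteIndex_le_mumfordTateGroup_map_of_isHodgeGenericPoint_familyPullback`, CMSP (15.7)).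
[cite: CarlsonMullerStachPeters2017, §15.3 (15.7) and Lemma–Definition 15.3.7] [cite: Deligne1972WeilK3, Prop. 7.5]
[cite: VoisinHodgeII2003, §3.1.2] -/
theorem exists_countable_finiteIndex_of_curve {p : ℕ} (hp : p.Prime) (h7 : 7 ≤ p)
    {P : SchemeOver ℂ} (hPq : IsQuasiProjectiveOver P) [SmoothOfRelativeDimension 1 P.hom]
    [IrreducibleSpace P.left] [PathConnectedSpace (ComplexPoints P)]
    (ι : haveI : NeZero p := ⟨hp.ne_zero⟩; P ⟶ cyclicCoverBase p)
    (A : haveI : NeZero p := ⟨hp.ne_zero⟩; ∀ t : ComplexPoints (cyclicCoverBase p), HodgeModel 2 (fiberOver (cyclicCoverFamily p) t))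
    (hA : ∀ t, (A t).IsHodgeSymmetric)
    (c₀ : ComplexPoints P) (t₀ : haveI : NeZero p := ⟨hp.ne_zero⟩; ComplexPoints (cyclicCoverBase p))
    (ht₀ : haveI : NeZero p := ⟨hp.ne_zero⟩; AlgPoints.map ι c₀ = t₀)
    (hFI : haveI : NeZero p := ⟨hp.ne_zero⟩
      haveI : HodgeTensorFacts.{0, 0} := hodgeTensorFacts_holds
      haveI : ∀ t : ComplexPoints (cyclicCoverBase p), Module.Finite ℚ (bettiCohomology (fiberOver (cyclicCoverFamily p) t) 2) :=
        fun t => finite ((isSmoothProjectiveFamily_cyclicCoverFamily p).isSmoothProjective t) 2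
      ∃ Γ₀ : Subgroup (bettiCohomology (fiberOver (cyclicCoverFamily p) t₀) 2 ≃ₗ[ℚ]
          bettiCohomology (fiberOver (cyclicCoverFamily p) t₀) 2),
        Γ₀ ≤ ratMonodromyGroup (cyclicCoverFamily p) 2 (cyclicCoverFamily_locallyTrivial p) ⟨t₀, Set.mem_univ _⟩ ∧
        (Γ₀.subgroupOf (ratMonodromyGroup (cyclicCoverFamily p) 2 (cyclicCoverFamily_locallyTrivial p) ⟨t₀, Set.mem_univ _⟩)).FiniteIndex ∧
        Γ₀ ≤ ((A t₀).hodgeStructure ((isSmoothProjectiveFamily_cyclicCoverFamily p).isSmoothProjective t₀) (hA t₀) 2).mumfordTateGroup) :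
    haveI : NeZero p := ⟨hp.ne_zero⟩
    haveI : HodgeTensorFacts.{0, 0} := hodgeTensorFacts_holds
    haveI : ∀ t : ComplexPoints (cyclicCoverBase p), Module.Finite ℚ (bettiCohomology (fiberOver (cyclicCoverFamily p) t) 2) :=
      fun t => finite ((isSmoothProjectiveFamily_cyclicCoverFamily p).isSmoothProjective t) 2
    ∃ C : Set (ComplexPoints P), C.Countable ∧ ∀ c : ComplexPoints P, c ∉ C →
      ∃ Γ₁ : Subgroup (bettiCohomology (fiberOver (cyclicCoverFamily p) (AlgPoints.map ι c)) 2 ≃ₗ[ℚ]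
          bettiCohomology (fiberOver (cyclicCoverFamily p) (AlgPoints.map ι c)) 2),
        Γ₁ ≤ ratMonodromyGroup (cyclicCoverFamily p) 2 (cyclicCoverFamily_locallyTrivial p) ⟨AlgPoints.map ι c, Set.mem_univ _⟩ ∧
        (Γ₁.subgroupOf (ratMonodromyGroup (cyclicCoverFamily p) 2 (cyclicCoverFamily_locallyTrivial p)
          ⟨AlgPoints.map ι c, Set.mem_univ _⟩)).FiniteIndex ∧
        Γ₁ ≤ ((A (AlgPoints.map ι c)).hodgeStructure ((isSmoothProjectiveFamily_cyclicCoverFamily p).isSmoothProjective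
          (AlgPoints.map ι c)) (hA (AlgPoints.map ι c)) 2).mumfordTateGroup := by
  haveI : NeZero p := ⟨hp.ne_zero⟩
  subst ht₀
  haveI hPs : AlgebraicGeometry.Smooth P.hom := AlgebraicGeometry.SmoothOfRelativeDimension.smooth 1 _
  haveI : AlgebraicGeometry.LocallyOfFiniteType P.hom := hPq.locallyOfFiniteType
  haveI : AlgebraicGeometry.IsSeparated P.hom := hPq.isVarietyPair_ofScheme.isSeparated
  haveI : HodgeTensorFacts.{0, 0} := hodgeTensorFacts_holds
  have hp2 : 2 ≤ p := by omega
  -- ### the two families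
  haveI := smoothOfRelativeDimension_baseSpz_hom ℂ 2 p (cyclicCoverSpz p)
  haveI : AlgebraicGeometry.LocallyOfFiniteType (cyclicCoverBase p).hom := locallyOfFiniteType_baseSpz_hom ℂ 2 p _
  haveI : AlgebraicGeometry.IsSeparated (cyclicCoverBase p).hom := isSeparated_baseSpz_hom ℂ 2 p _
  have hf := isSmoothProjectiveFamily_cyclicCoverFamily p
  have hU := cyclicCoverFamily_locallyTrivial p
  have hf' : IsSmoothProjectiveFamily (familyPullback.snd (cyclicCoverFamily p) ι) 2 := hf.familyPullback_snd ι
  have hU' := isCohomologicallyLocallyTrivialOn_univ_of_isQuasiProjectiveOver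
    (familyPullback.snd (cyclicCoverFamily p) ι) hf' hPq inferInstance
  haveI : ∀ t : ComplexPoints (cyclicCoverBase p), Module.Finite ℚ (bettiCohomology (fiberOver (cyclicCoverFamily p) t) 2) :=
    fun t => finite (hf.isSmoothProjective t) 2
  haveI : ∀ c : ComplexPoints P,
      Module.Finite ℚ (bettiCohomology (fiberOver (familyPullback.snd (cyclicCoverFamily p) ι) c) 2) :=
    fun c => finite (hf'.isSmoothProjective c) 2
  -- real (hence Hodge-symmetric) Hodge models of the fibres of the pulled-back family
  have hAm' := fun c : ComplexPoints P =>
    exists_isReal_hodgeModel_holds.exists_isHodgeSymmetric (hf'.isSmoothProjective c)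
  let A' : ∀ c : ComplexPoints P, HodgeModel 2 (fiberOver (familyPullback.snd (cyclicCoverFamily p) ι) c) :=
    fun c => (hAm' c).choose
  have hA' : ∀ c, (A' c).IsHodgeSymmetric := fun c => (hAm' c).choose_spec
  -- ### frames for the pulled-back family (Griffiths residues, pulled back along `ι`)
  have hF2' := exists_frames_familyPullback_chartAt (cyclicCoverFamily p) ι
    (m := 0 + Nat.card (TernaryIndex p)) (m' := 1) 2 2 hf hU hU' A hA A' hA'
    (fun s t₁ N hN T₁ => by
      obtain ⟨W₀, hW₀o, ht₁W₀, hW₀N, hW₀pc, ψ, ⟨hψa, hψs, hψy⟩, hW₀ψ, r₂, w₂, hw₂, hhol⟩ :=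
        exists_topFormFrame_familySpz_chartAt 1 p (cyclicCoverSpz p) (by omega) (0 + Nat.card (TernaryIndex p))
          hf hU A hA s t₁ N hN T₁
      exact ⟨W₀, hW₀o, ht₁W₀, hW₀N, hW₀pc, ψ, ⟨t₁.1, hψa, hψs, hψy⟩, hW₀ψ, r₂, w₂, hw₂, hhol⟩)
  -- ### the countable exceptional set of the curve
  have hε' : ∀ c : ComplexPoints P, IsClosedImmersion
      (fiberι (familyPullback.snd (cyclicCoverFamily p) ι) c ≫
        (familyPullback.fst (cyclicCoverFamily p) ι ≫
          (totalSpzToTotal ℂ 2 p (cyclicCoverSpz p) ≫ toProjectiveSpace ℂ 2 p))).left := by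
    intro c
    have heq : fiberι (familyPullback.snd (cyclicCoverFamily p) ι) c ≫
        (familyPullback.fst (cyclicCoverFamily p) ι ≫ (totalSpzToTotal ℂ 2 p (cyclicCoverSpz p) ≫ toProjectiveSpace ℂ 2 p)) =
        (fiberOverFamilyPullbackIso (cyclicCoverFamily p) ι c).hom ≫
          (fiberι (cyclicCoverFamily p) (AlgPoints.map ι c) ≫
            (totalSpzToTotal ℂ 2 p (cyclicCoverSpz p) ≫ toProjectiveSpace ℂ 2 p)) := by
      rw [← Category.assoc, ← fiberOverFamilyPullbackIso_hom_fiberι, Category.assoc]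
    rw [heq]
    haveI := isClosedImmersion_fiberι_familySpz_toProjectiveSpace ℂ 2 p (cyclicCoverSpz p) (AlgPoints.map ι c)
    change IsClosedImmersion ((fiberOverFamilyPullbackIso (cyclicCoverFamily p) ι c).hom.left ≫
      (fiberι (cyclicCoverFamily p) (AlgPoints.map ι c) ≫
        (totalSpzToTotal ℂ 2 p (cyclicCoverSpz p) ≫ toProjectiveSpace ℂ 2 p)).left)
    infer_instance
  obtain ⟨C, hCc, hgen⟩ := exists_countable_isHodgeGenericPoint_of_weightTwoFrames_curve
    (familyPullback.snd (cyclicCoverFamily p) ι) hf' hPq hU' A' hA' (show 1 ≤ 2 + 1 by norm_num)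
    (familyPullback.fst (cyclicCoverFamily p) ι ≫ (totalSpzToTotal ℂ 2 p (cyclicCoverSpz p) ≫ toProjectiveSpace ℂ 2 p))
    hε' (fun ψ' => ∃ P₀' : ComplexPoints P,
      (∀ t, (ψ' t : Fin 1 → ℂ) = ComplexPoints.algebraicChart P 1 P₀' t.1) ∧
        (∀ t, t ∈ ψ'.source ↔ t.1 ∈ (ComplexPoints.algebraicChart P 1 P₀').source) ∧
        (∀ z, ((ψ'.symm z : (Set.univ : Set (ComplexPoints P))) : ComplexPoints P) =
          (ComplexPoints.algebraicChart P 1 P₀').symm z)) (fun s' t₁' N' hN' T₁' _ => hF2' s' t₁' N' hN' T₁')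
  refine ⟨C, hCc, fun c hc => ?_⟩
  -- ### at a point `c ∉ C`: `c` is Hodge generic for the curve family
  have hgenc := hgen ⟨c, Set.mem_univ _⟩ hc
  -- ### a path from `c` to `c₀` in `P(ℂ)` and the rational transport of `π'` along it
  let γ : Path c c₀ := PathConnectedSpace.somePath c c₀
  let γ' : Path (⟨c, Set.mem_univ _⟩ : (Set.univ : Set (ComplexPoints P))) ⟨c₀, Set.mem_univ _⟩ :=
    γ.map (f := fun x : ComplexPoints P => (⟨x, Set.mem_univ x⟩ : (Set.univ : Set (ComplexPoints P))))
      (continuous_id.subtype_mk _)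
  have hrat' : ∀ (s t : (Set.univ : Set (ComplexPoints P))) (δ : Path.Homotopic.Quotient s t)
      (α : complexBetti (fiberOver (familyPullback.snd (cyclicCoverFamily p) ι) s.1) 2),
      IsRationalClass α → IsRationalClass (transportFun (familyPullback.snd (cyclicCoverFamily p) ι) 2 hU' δ α) :=
    fun s t δ α hα => isRationalClass_transportFun_of_isSmoothProjectiveFamily _ 2 1 hf' hPq δ hα
  obtain ⟨T', hT'⟩ := exists_ratTransport (familyPullback.snd (cyclicCoverFamily p) ι) 2 hU' hrat' ⟦γ'⟧
  -- ### HEREDITY H1 for the base change `ι`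
  exact exists_finiteIndex_le_mumfordTateGroup_map_of_isHodgeGenericPoint_familyPullback (cyclicCoverFamily p) ι 2 hU hU'
    hf A hA A' hA' hgenc hT' hFI

/-- **HC on all self-powers of all but countably many members of an algebraic curve of `p`-cyclic surfaces through ONE
member with FI** (`p ≥ 7` prime; setting of `exists_countable_finiteIndex_of_curve`): there is a countable `C ⊆ P(ℂ)`
such that for every `c ∉ C`, every smooth projective `X ⊂ ℙ³` cut out by `x₃^p − f_{ι c}` and every self fibre power
`Y = X^{k+1}` satisfy `HodgeConjectureFor (2(k+1)) Y`. Unconditional; NOT items 19544 ∕ 19543 (CDK floor).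
[cite: CarlsonMullerStachPeters2017, §15.3 (15.7) and Lemma–Definition 15.3.7] [cite: CarlsonToledo1999, §7 Theorem 7.1]
[cite: Deligne1972WeilK3, Prop. 7.5] -/
theorem hodgeConjectureFor_powers_offCountable_of_curve_of_finiteIndex {p : ℕ} (hp : p.Prime) (h7 : 7 ≤ p)
    {P : SchemeOver ℂ} (hPq : IsQuasiProjectiveOver P) [SmoothOfRelativeDimension 1 P.hom]
    [IrreducibleSpace P.left] [PathConnectedSpace (ComplexPoints P)]
    (ι : haveI : NeZero p := ⟨hp.ne_zero⟩; P ⟶ cyclicCoverBase p)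
    (A : haveI : NeZero p := ⟨hp.ne_zero⟩; ∀ t : ComplexPoints (cyclicCoverBase p), HodgeModel 2 (fiberOver (cyclicCoverFamily p) t))
    (hA : ∀ t, (A t).IsHodgeSymmetric)
    (c₀ : ComplexPoints P) (t₀ : haveI : NeZero p := ⟨hp.ne_zero⟩; ComplexPoints (cyclicCoverBase p))
    (ht₀ : haveI : NeZero p := ⟨hp.ne_zero⟩; AlgPoints.map ι c₀ = t₀)
    (hFI : haveI : NeZero p := ⟨hp.ne_zero⟩
      haveI : HodgeTensorFacts.{0, 0} := hodgeTensorFacts_holds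
      haveI : ∀ t : ComplexPoints (cyclicCoverBase p), Module.Finite ℚ (bettiCohomology (fiberOver (cyclicCoverFamily p) t) 2) :=
        fun t => finite ((isSmoothProjectiveFamily_cyclicCoverFamily p).isSmoothProjective t) 2
      ∃ Γ₀ : Subgroup (bettiCohomology (fiberOver (cyclicCoverFamily p) t₀) 2 ≃ₗ[ℚ]
          bettiCohomology (fiberOver (cyclicCoverFamily p) t₀) 2),
        Γ₀ ≤ ratMonodromyGroup (cyclicCoverFamily p) 2 (cyclicCoverFamily_locallyTrivial p) ⟨t₀, Set.mem_univ _⟩ ∧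
        (Γ₀.subgroupOf (ratMonodromyGroup (cyclicCoverFamily p) 2 (cyclicCoverFamily_locallyTrivial p) ⟨t₀, Set.mem_univ _⟩)).FiniteIndex ∧
        Γ₀ ≤ ((A t₀).hodgeStructure ((isSmoothProjectiveFamily_cyclicCoverFamily p).isSmoothProjective t₀) (hA t₀) 2).mumfordTateGroup) :
    haveI : NeZero p := ⟨hp.ne_zero⟩
    ∃ C : Set (ComplexPoints P), C.Countable ∧ ∀ c : ComplexPoints P, c ∉ C →
      ∀ ⦃X : SchemeOver ℂ⦄, IsSmoothProjective 2 X →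
        IsHypersurfaceCutOutBy 3 (MvPolynomial.X (Fin.last 3) ^ p - MvPolynomial.rename Fin.castSucc
          (∑ e : TernaryIndex p, MvPolynomial.monomial e.1 ((branchForm p (AlgPoints.map ι c)).coeff e.1))) X →
        ∀ ⦃k : ℕ⦄ ⦃Y : SchemeOver ℂ⦄, (∃ π : Fin (k + 1) → (Y ⟶ X), Nonempty (IsLimit (Fan.mk Y π))) →
          HodgeConjectureFor (2 * (k + 1)) Y := by
  haveI : NeZero p := ⟨hp.ne_zero⟩
  obtain ⟨C, hCc, hC⟩ := exists_countable_finiteIndex_of_curve hp h7 hPq ι A hA c₀ t₀ ht₀ hFI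
  exact ⟨C, hCc, fun c hc X hX hcut k Y hY => hodgeConjectureFor_powers_of_finiteIndex_at hp h7 A hA _ (hC c hc) hX hcut hY⟩

/-! ### §3 Curves through a Hodge-generic point of the Carlson–Toledo family -/

/-- **Every algebraic curve of `p`-cyclic surfaces through a HODGE-GENERIC member has all but countably many good
members** (`p ≥ 7` prime; setting of `exists_countable_finiteIndex_of_curve`): if `ι c₀` is a Hodge-generic point of the
Carlson–Toledo family (`IsHodgeGenericPoint`, read in the models `A`), Deligne's lemma (CMSP Lemma–Def. 15.3.7 (i), tree
theorem `deligne_finiteIndex_monodromy_le_mumfordTateGroup_of_isQuasiProjectiveOver`) supplies FI at `ι c₀`, and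
`hodgeConjectureFor_powers_offCountable_of_curve_of_finiteIndex` applies. Unconditional; the hypothesis is transcendental
(no point is shown Hodge generic here); NOT items 19544 ∕ 19543. [cite: CarlsonMullerStachPeters2017, Definition 15.3.5 and Lemma–Definition 15.3.7]
[cite: Deligne1972WeilK3, Prop. 7.5] [cite: CarlsonToledo1999, §7 Theorem 7.1] -/
theorem hodgeConjectureFor_powers_offCountable_of_curve_of_isHodgeGenericPoint {p : ℕ} (hp : p.Prime) (h7 : 7 ≤ p)
    {P : SchemeOver ℂ} (hPq : IsQuasiProjectiveOver P) [SmoothOfRelativeDimension 1 P.hom]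
    [IrreducibleSpace P.left] [PathConnectedSpace (ComplexPoints P)]
    (ι : haveI : NeZero p := ⟨hp.ne_zero⟩; P ⟶ cyclicCoverBase p)
    (A : haveI : NeZero p := ⟨hp.ne_zero⟩; ∀ t : ComplexPoints (cyclicCoverBase p), HodgeModel 2 (fiberOver (cyclicCoverFamily p) t))
    (hA : ∀ t, (A t).IsHodgeSymmetric) (c₀ : ComplexPoints P)
    (hgen : haveI : NeZero p := ⟨hp.ne_zero⟩
      haveI : HodgeTensorFacts.{0, 0} := hodgeTensorFacts_holds
      haveI : ∀ t : ComplexPoints (cyclicCoverBase p), Module.Finite ℚ (bettiCohomology (fiberOver (cyclicCoverFamily p) t) 2) :=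
        fun t => finite ((isSmoothProjectiveFamily_cyclicCoverFamily p).isSmoothProjective t) 2
      IsHodgeGenericPoint (cyclicCoverFamily p) 2 (cyclicCoverFamily_locallyTrivial p)
        (isSmoothProjectiveFamily_cyclicCoverFamily p) A hA ⟨AlgPoints.map ι c₀, Set.mem_univ _⟩) :
    haveI : NeZero p := ⟨hp.ne_zero⟩
    ∃ C : Set (ComplexPoints P), C.Countable ∧ ∀ c : ComplexPoints P, c ∉ C →
      ∀ ⦃X : SchemeOver ℂ⦄, IsSmoothProjective 2 X →
        IsHypersurfaceCutOutBy 3 (MvPolynomial.X (Fin.last 3) ^ p - MvPolynomial.rename Fin.castSucc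
          (∑ e : TernaryIndex p, MvPolynomial.monomial e.1 ((branchForm p (AlgPoints.map ι c)).coeff e.1))) X →
        ∀ ⦃k : ℕ⦄ ⦃Y : SchemeOver ℂ⦄, (∃ π : Fin (k + 1) → (Y ⟶ X), Nonempty (IsLimit (Fan.mk Y π))) →
          HodgeConjectureFor (2 * (k + 1)) Y := by
  haveI : NeZero p := ⟨hp.ne_zero⟩
  haveI : HodgeTensorFacts.{0, 0} := hodgeTensorFacts_holds
  have hf := isSmoothProjectiveFamily_cyclicCoverFamily p
  haveI : ∀ t : ComplexPoints (cyclicCoverBase p), Module.Finite ℚ (bettiCohomology (fiberOver (cyclicCoverFamily p) t) 2) :=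
    fun t => finite (hf.isSmoothProjective t) 2
  have hFI := (deligne_finiteIndex_monodromy_le_mumfordTateGroup_of_isQuasiProjectiveOver (cyclicCoverFamily p) 2 2 hf
    (isQuasiProjectiveOver_totalSpz 2 p (cyclicCoverSpz p) (cyclicCoverSpz_surjective p (NeZero.ne p)))
    (isQuasiProjectiveOver_baseSpz 2 p (cyclicCoverSpz p)) (smooth_baseSpz_hom ℂ 2 p (cyclicCoverSpz p))
    (irreducibleSpace_cyclicCoverBase p) (cyclicCoverFamily_locallyTrivial p) A hA ⟨AlgPoints.map ι c₀, Set.mem_univ _⟩ hgen).1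
  exact hodgeConjectureFor_powers_offCountable_of_curve_of_finiteIndex hp h7 hPq ι A hA c₀ _ rfl hFI

end Summit.HodgeConjecture.HodgeConjecture.Theorems.CyclicUnitaryPowersHeredity

end
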